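import Summits.ValiantsHypothesis.ValiantsHypothesis.Theorems.BarrierLeverAnchoredDoorHitsLowerPairsSplitFamilySmall
import Summits.ValiantsHypothesis.ValiantsHypothesis.Theorems.BarrierLeverAnchoredDoorHitsLowerPairsLTRest

/-!
# Support item `AnchoredDoorHitsLowerPairs` (stmt-ValiantsHypothesis-22510), line `anchored-peeling`:
# CONJECTURE SP for all `m` — part 1: ZEON CONVOLUTION CALCULUS (coefficient functions of x-only door products)

Helper file (`--supports stmt-ValiantsHypothesis-22510`; cell valiant-natproofs, rung V4, 𝒟-side door (c); registered line
`Cruxes/AnchoredDoorHitsLowerPairs/Lines/anchored_peeling.lean` v24, registered stub `stub_splitFamilyGe3` = CONJECTURE SP for `m ≥ 3`;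
prover seat val-np-p1 gen 24; memo HOME/val-np-p1/g24/MEMO-SP-proof-valnp1-g24.md §6 B1). Closes NO item.

WHAT. Reading the square-free coefficient `[x^U]` of an `x`-only element of `ℂ[x, y]` is the coordinate map of the ZEON ALGEBRA `ℂ[x]/(x_i²)`; products
become DISJOINT-UNION CONVOLUTIONS of coefficient functions `Finset (Fin h) → R`:
* `conv f g U = Σ_{V ⊆ U} f V · g (U ∖ V)` (`SplitGeneral.conv`), bilinear, with `conv (dlt A) g U = [A ⊆ U] g (U ∖ A)` for the delta function `dlt A`;
* `coeff_pexpo_mul_conv`: `[x^U] (F · G) = conv ([x^·] F) ([x^·] G) U` for ALL `F, G` (the antidiagonal of a 0/1 exponent is the set of splittings);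
* `coeff_pexpo_doorElem`: `[x^U] D_γ = Σ_{b ∈ U} θ_{bγ} ∏_{b' ∈ U∖b} φ_{bγb'}` (the door coefficient function `doorFun`); `coeff_pexpo_one'`;
* polynomial-valued coefficient functions (one scale `L`): `natDegree (conv f g U) ≤ a + b` and the TOP coefficient of a convolution is the convolution of
  the top coefficients (`natDegree_conv_le`, `coeff_conv_top`); `eval` commutes with `conv` (`eval_conv`).
These are the tools of the leading-term argument of the sequel files (`…SplitGeneralDesign`, `…SplitGeneralCore`, `…SplitGeneral`).

WHAT THIS IS NOT: nothing here is specific to the split family; nothing on crux stmt-ValiantsHypothesis-14610 or on `VP` versus `VNP`.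
-/

set_option linter.dupNamespace false

namespace Summit.ValiantsHypothesis.ValiantsHypothesis.Theorems.BarrierLever.AnchoredPeeling

open Finset MvPolynomial
open Summit.ValiantsHypothesis.ValiantsHypothesis.Theorems.BarrierLever.BrickCalculus (pexpo pexpo_def pexpo_le_iff pexpo_sub pexpo_apply_castAdd
  pexpo_apply_natAdd)

namespace SplitGeneral

/-! ## 1. Convolution of coefficient functions -/

section Conv

variable {α : Type*} [DecidableEq α] {R : Type*} [CommSemiring R]

/-- The zeon convolution: `conv f g U = Σ_{V ⊆ U} f V · g (U ∖ V)`. -/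
def conv (f g : Finset α → R) (U : Finset α) : R := ∑ V ∈ U.powerset, f V * g (U \ V)

/-- The delta function of the face `A`. -/
def dlt (A : Finset α) : Finset α → R := fun U => if U = A then 1 else 0

/-- Convolution with a delta on the left: `conv (dlt A) g U = [A ⊆ U] · g (U ∖ A)`. -/
theorem conv_dlt_left (A : Finset α) (g : Finset α → R) (U : Finset α) :
    conv (dlt A) g U = if A ⊆ U then g (U \ A) else 0 := by
  unfold conv dlt
  by_cases hA : A ⊆ U
  · rw [if_pos hA, Finset.sum_eq_single A]
    · rw [if_pos rfl, one_mul]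
    · intro V _ hVA; rw [if_neg hVA, zero_mul]
    · intro hAU; exact absurd (Finset.mem_powerset.mpr hA) hAU
  · rw [if_neg hA]
    exact Finset.sum_eq_zero (fun V hV => by
      rw [if_neg (fun hVA => hA (by rw [← hVA]; exact Finset.mem_powerset.mp hV)), zero_mul])

/-- Convolution with a delta on the right: `conv f (dlt A) U = [A ⊆ U] · f (U ∖ A)`. -/
theorem conv_dlt_right (f : Finset α → R) (A : Finset α) (U : Finset α) :
    conv f (dlt A) U = if A ⊆ U then f (U \ A) else 0 := by
  unfold conv dlt
  by_cases hA : A ⊆ U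
  · rw [if_pos hA, Finset.sum_eq_single (U \ A)]
    · rw [Finset.sdiff_sdiff_eq_self hA, if_pos rfl, mul_one]
    · intro V hV hVA
      rw [if_neg, mul_zero]
      intro hUV
      apply hVA
      rw [← hUV, Finset.sdiff_sdiff_eq_self (Finset.mem_powerset.mp hV)]
    · intro hAU; exact absurd (Finset.mem_powerset.mpr Finset.sdiff_subset) hAU
  · rw [if_neg hA]
    exact Finset.sum_eq_zero (fun V _ => by
      rw [if_neg (fun hUV => hA (by rw [← hUV]; exact Finset.sdiff_subset)), mul_zero])

/-- Commutativity of the convolution. -/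
theorem conv_comm (f g : Finset α → R) (U : Finset α) : conv f g U = conv g f U := by
  unfold conv
  refine Finset.sum_nbij' (fun V => U \ V) (fun V => U \ V) ?_ ?_ ?_ ?_ ?_
  · intro V _; exact Finset.mem_powerset.mpr Finset.sdiff_subset
  · intro V _; exact Finset.mem_powerset.mpr Finset.sdiff_subset
  · intro V hV; exact Finset.sdiff_sdiff_eq_self (Finset.mem_powerset.mp hV)
  · intro V hV; exact Finset.sdiff_sdiff_eq_self (Finset.mem_powerset.mp hV)
  · intro V hV; rw [Finset.sdiff_sdiff_eq_self (Finset.mem_powerset.mp hV), mul_comm]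

/-- Convolution of two deltas: `[A ∩ B = ∅][U = A ∪ B]`. -/
theorem conv_dlt_dlt (A B U : Finset α) : conv (dlt A) (dlt B) U = (if Disjoint A B ∧ U = A ∪ B then 1 else 0 : R) := by
  rw [conv_dlt_left]
  unfold dlt
  by_cases hA : A ⊆ U
  · rw [if_pos hA]
    by_cases hB : U \ A = B
    · rw [if_pos hB, if_pos]
      refine ⟨?_, ?_⟩
      · rw [← hB]; exact Finset.disjoint_sdiff
      · rw [← hB, Finset.union_sdiff_of_subset hA]
    · rw [if_neg hB, if_neg]
      rintro ⟨hd, hU⟩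
      apply hB
      rw [hU, Finset.union_sdiff_left, Finset.sdiff_eq_self_iff_disjoint]
      exact hd.symm
  · rw [if_neg hA, if_neg]
    rintro ⟨_, hU⟩
    exact hA (hU ▸ Finset.subset_union_left)

/-- Transport of a convolution along an injective map of the ground set. -/
theorem conv_image {β : Type*} [DecidableEq β] (e : α → β) (hinj : Function.Injective e) (F G : Finset β → R) (U : Finset α) :
    conv F G (U.image e) = conv (fun V => F (V.image e)) (fun V => G (V.image e)) U := by
  unfold conv
  symm
  refine Finset.sum_nbij' (fun V => V.image e) (fun D => U.filter (fun a => e a ∈ D)) ?_ ?_ ?_ ?_ ?_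
  · intro V hV; exact Finset.mem_powerset.mpr (Finset.image_subset_image (Finset.mem_powerset.mp hV))
  · intro D _; exact Finset.mem_powerset.mpr (Finset.filter_subset _ _)
  · intro V hV
    have hVU := Finset.mem_powerset.mp hV
    ext a
    simp only [Finset.mem_filter, Finset.mem_image]
    constructor
    · rintro ⟨_, a', ha', hee⟩; rw [← hinj hee]; exact ha'
    · intro ha; exact ⟨hVU ha, a, ha, rfl⟩
  · intro D hD
    have hDU := Finset.mem_powerset.mp hD
    ext b
    simp only [Finset.mem_image, Finset.mem_filter]
    constructor
    · rintro ⟨a, ⟨_, hab⟩, rfl⟩; exact hab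
    · intro hb
      obtain ⟨a, haU, rfl⟩ := Finset.mem_image.mp (hDU hb)
      exact ⟨a, ⟨haU, hb⟩, rfl⟩
  · intro V hV
    have hVU := Finset.mem_powerset.mp hV
    show F (V.image e) * G ((U \ V).image e) = F (V.image e) * G (U.image e \ V.image e)
    rw [Finset.image_sdiff_of_injOn hinj.injOn hVU]

/-- Additivity in the left argument. -/
theorem conv_add_left (f₁ f₂ g : Finset α → R) (U : Finset α) : conv (f₁ + f₂) g U = conv f₁ g U + conv f₂ g U := by
  unfold conv; rw [← Finset.sum_add_distrib]; exact Finset.sum_congr rfl (fun V _ => by rw [Pi.add_apply, add_mul])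

/-- Additivity in the right argument. -/
theorem conv_add_right (f g₁ g₂ : Finset α → R) (U : Finset α) : conv f (g₁ + g₂) U = conv f g₁ U + conv f g₂ U := by
  unfold conv; rw [← Finset.sum_add_distrib]; exact Finset.sum_congr rfl (fun V _ => by rw [Pi.add_apply, mul_add])

/-- Homogeneity in the left argument. -/
theorem conv_smul_left (c : R) (f g : Finset α → R) (U : Finset α) : conv (c • f) g U = c * conv f g U := by
  unfold conv; rw [Finset.mul_sum]; exact Finset.sum_congr rfl (fun V _ => by rw [Pi.smul_apply, smul_eq_mul, mul_assoc])

/-- Homogeneity in the right argument. -/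
theorem conv_smul_right (c : R) (f g : Finset α → R) (U : Finset α) : conv f (c • g) U = c * conv f g U := by
  unfold conv; rw [Finset.mul_sum]; exact Finset.sum_congr rfl (fun V _ => by rw [Pi.smul_apply, smul_eq_mul, mul_left_comm])

/-- A ring map commutes with convolution. -/
theorem map_conv {S : Type*} [CommSemiring S] (φ : R →+* S) (f g : Finset α → R) (U : Finset α) :
    φ (conv f g U) = conv (fun V => φ (f V)) (fun V => φ (g V)) U := by
  unfold conv; rw [map_sum]; exact Finset.sum_congr rfl (fun V _ => by rw [map_mul])

end Conv

/-! ## 2. Polynomial-valued coefficient functions: degree and top coefficient of a convolution -/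

section Poly

variable {α : Type*} [DecidableEq α] {A : Type*} [CommRing A]

/-- Degree of a convolution under uniform degree bounds. -/
theorem natDegree_conv_le (f g : Finset α → Polynomial A) (a b : ℕ) (hf : ∀ V, (f V).natDegree ≤ a) (hg : ∀ V, (g V).natDegree ≤ b)
    (U : Finset α) : (conv f g U).natDegree ≤ a + b := by
  unfold conv
  refine Polynomial.natDegree_sum_le_of_forall_le _ _ (fun V _ => ?_)
  exact Polynomial.natDegree_mul_le.trans (Nat.add_le_add (hf V) (hg _))

/-- **Top coefficient of a convolution = convolution of the top coefficients.** -/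
theorem coeff_conv_top (f g : Finset α → Polynomial A) (a b : ℕ) (hf : ∀ V, (f V).natDegree ≤ a) (hg : ∀ V, (g V).natDegree ≤ b)
    (U : Finset α) : (conv f g U).coeff (a + b) = conv (fun V => (f V).coeff a) (fun V => (g V).coeff b) U := by
  unfold conv
  rw [Polynomial.finsetSum_coeff]
  exact Finset.sum_congr rfl (fun V _ => Polynomial.coeff_mul_add_eq_of_natDegree_le (hf V) (hg _))

/-- Evaluation commutes with convolution. -/
theorem eval_conv (f g : Finset α → Polynomial A) (x : A) (U : Finset α) :
    (conv f g U).eval x = conv (fun V => (f V).eval x) (fun V => (g V).eval x) U :=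
  map_conv (Polynomial.evalRingHom x) f g U

end Poly

/-! ## 3. The bridge to `MvPolynomial`: `[x^U]` of products and of door elements -/

section Bridge

variable {h : ℕ}

/-- Splittings of a 0/1 exponent: if `d₁ + d₂ = pexpo U ∅` then `d₁ = pexpo V ∅` and `d₂ = pexpo (U ∖ V) ∅` for `V = {u ∈ U : d₁(x_u) ≠ 0}`. -/
theorem eq_pexpo_of_add_eq_pexpo (U : Finset (Fin h)) (d₁ d₂ : Fin (h + h) →₀ ℕ) (hd : d₁ + d₂ = pexpo U ∅) :
    d₁ = pexpo (U.filter (fun u => d₁ (Fin.castAdd h u) ≠ 0)) ∅ ∧ d₂ = pexpo (U \ U.filter (fun u => d₁ (Fin.castAdd h u) ≠ 0)) ∅ := by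
  classical
  set V := U.filter (fun u => d₁ (Fin.castAdd h u) ≠ 0) with hVdef
  have hmemV : ∀ u, u ∈ V ↔ u ∈ U ∧ d₁ (Fin.castAdd h u) ≠ 0 := fun u => by rw [hVdef, Finset.mem_filter]
  have hpt : ∀ i, d₁ i + d₂ i = pexpo U ∅ i := fun i => by rw [← Finsupp.add_apply, hd]
  have h1 : d₁ = pexpo V ∅ := by
    ext i
    refine Fin.addCases (fun a => ?_) (fun c => ?_) i
    · have ha := hpt (Fin.castAdd h a)
      rw [pexpo_apply_castAdd] at ha
      rw [pexpo_apply_castAdd]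
      by_cases haV : a ∈ V
      · rw [if_pos haV]
        have hne := ((hmemV a).mp haV).2
        have hle : d₁ (Fin.castAdd h a) ≤ 1 := by
          by_cases haU : a ∈ U
          · rw [if_pos haU] at ha; omega
          · rw [if_neg haU] at ha; omega
        omega
      · rw [if_neg haV]
        by_contra hne
        by_cases haU : a ∈ U
        · exact haV ((hmemV a).mpr ⟨haU, hne⟩)
        · rw [if_neg haU] at ha; omega
    · have hc := hpt (Fin.natAdd h c)
      rw [pexpo_apply_natAdd, if_neg (Finset.notMem_empty c)] at hc
      rw [pexpo_apply_natAdd, if_neg (Finset.notMem_empty c)]; omega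
  refine ⟨h1, ?_⟩
  have h2 : d₂ = pexpo U ∅ - d₁ := by rw [← hd, add_tsub_cancel_left]
  have h3 : pexpo U ∅ - d₁ = pexpo U ∅ - pexpo V ∅ := congrArg _ h1
  rw [h2, h3, pexpo_sub _ _ _ _ (Finset.filter_subset _ _) (Finset.empty_subset _), Finset.sdiff_empty]

/-- **`[x^U] (F · G) = conv ([x^·] F) ([x^·] G) U`** for all `F, G ∈ ℂ[x, y]` (any coefficient ring). -/
theorem coeff_pexpo_mul_conv {R : Type*} [CommSemiring R] (F G : MvPolynomial (Fin (h + h)) R) (U : Finset (Fin h)) :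
    coeff (pexpo U ∅) (F * G) = conv (fun V => coeff (pexpo V ∅) F) (fun V => coeff (pexpo V ∅) G) U := by
  classical
  rw [coeff_mul, conv]
  refine Finset.sum_nbij' (fun d => U.filter (fun u => d.1 (Fin.castAdd h u) ≠ 0)) (fun V => (pexpo V ∅, pexpo (U \ V) ∅)) ?_ ?_ ?_ ?_ ?_
  · intro d _; exact Finset.mem_powerset.mpr (Finset.filter_subset _ _)
  · intro V hV
    rw [Finset.HasAntidiagonal.mem_antidiagonal, ← pexpo_union Finset.disjoint_sdiff (Finset.disjoint_empty_left _), Finset.empty_union,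
      Finset.union_sdiff_of_subset (Finset.mem_powerset.mp hV)]
  · intro d hd
    obtain ⟨h1, h2⟩ := eq_pexpo_of_add_eq_pexpo U d.1 d.2 (Finset.HasAntidiagonal.mem_antidiagonal.mp hd)
    exact Prod.ext h1.symm h2.symm
  · intro V hV
    have hVU := Finset.mem_powerset.mp hV
    ext u
    simp only [Finset.mem_filter, pexpo_apply_castAdd]
    constructor
    · rintro ⟨_, hne⟩; by_contra huV; exact hne (if_neg huV)
    · intro huV; exact ⟨hVU huV, by rw [if_pos huV]; exact one_ne_zero⟩
  · intro d hd
    obtain ⟨h1, h2⟩ := eq_pexpo_of_add_eq_pexpo U d.1 d.2 (Finset.HasAntidiagonal.mem_antidiagonal.mp hd)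
    rw [← h1, ← h2]

/-- `[x^U] 1 = [U = ∅]`. -/
theorem coeff_pexpo_one' {R : Type*} [CommSemiring R] (U : Finset (Fin h)) :
    coeff (pexpo U ∅) (1 : MvPolynomial (Fin (h + h)) R) = if U = ∅ then 1 else 0 := by
  classical
  rw [MvPolynomial.coeff_one]
  by_cases hU : U = ∅
  · rw [if_pos hU, if_pos ((pexpo_empty_right_eq_zero_iff U).mpr hU).symm]
  · rw [if_neg hU, if_neg (fun h0 => hU ((pexpo_empty_right_eq_zero_iff U).mp h0.symm))]

/-- The door coefficient function of a vertex `γ` for the parameters `(θ, φ)`: `U ↦ Σ_{b ∈ U} θ_{bγ} ∏_{b' ∈ U∖b} φ_{bγb'}` (any commutative ring). -/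
def doorFun {R : Type*} [CommSemiring R] (θ : Fin h → Fin h → R) (φ : Fin h → Fin h → Fin h → R) (γ : Fin h) (U : Finset (Fin h)) : R :=
  ∑ b ∈ U, θ b γ * ∏ b' ∈ U.erase b, φ b γ b'

/-- **`[x^U] D_γ = doorFun θ φ γ U`.** -/
theorem coeff_pexpo_doorElem (θ : Fin h → Fin h → ℂ) (φ : Fin h → Fin h → Fin h → ℂ) (γ : Fin h) (U : Finset (Fin h)) :
    coeff (pexpo U ∅) (doorElem θ φ γ) = doorFun θ φ γ U := by
  classical
  rw [doorElem, coeff_sum, doorFun, ← Finset.sum_filter_add_sum_filter_not Finset.univ (fun b => b ∈ U)]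
  have hz : ∑ b ∈ Finset.univ.filter (fun b => ¬ b ∈ U), coeff (pexpo U ∅) (cfacCore (fun b => θ b γ) (fun b b' => φ b γ b') b) = 0 :=
    Finset.sum_eq_zero (fun b hb => by rw [coeff_cfacCore, if_neg (Finset.mem_filter.mp hb).2])
  rw [hz, add_zero]
  have hset : Finset.univ.filter (fun b => b ∈ U) = U := by ext b; simp
  rw [hset]
  exact Finset.sum_congr rfl (fun b hb => by rw [coeff_cfacCore, if_pos hb])

/-- A ring map acts on door coefficient functions parameterwise. -/
theorem map_doorFun {R S : Type*} [CommSemiring R] [CommSemiring S] (ψ : R →+* S) (θ : Fin h → Fin h → R) (φ : Fin h → Fin h → Fin h → R)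
    (γ : Fin h) (U : Finset (Fin h)) :
    ψ (doorFun θ φ γ U) = doorFun (fun b γ => ψ (θ b γ)) (fun b γ b' => ψ (φ b γ b')) γ U := by
  unfold doorFun; rw [map_sum]; exact Finset.sum_congr rfl (fun b _ => by rw [map_mul, map_prod])

/-- **Entries of the door layout for faces of size ≤ 2**, as coefficient functions: `∅ ↦ [U = ∅]`, `{γ} ↦ doorFun γ`, `{γ, γ'} ↦ conv`. -/
theorem coeff_pexpo_prod_doorElem_pair (θ : Fin h → Fin h → ℂ) (φ : Fin h → Fin h → Fin h → ℂ) {γ γ' : Fin h} (hne : γ ≠ γ') (U : Finset (Fin h)) :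
    coeff (pexpo U ∅) (∏ y ∈ ({γ, γ'} : Finset (Fin h)), doorElem θ φ y) = conv (doorFun θ φ γ) (doorFun θ φ γ') U := by
  classical
  rw [Finset.prod_pair hne, coeff_pexpo_mul_conv]
  have e1 : (fun V => coeff (pexpo V ∅) (doorElem θ φ γ)) = doorFun θ φ γ := funext (coeff_pexpo_doorElem θ φ γ)
  have e2 : (fun V => coeff (pexpo V ∅) (doorElem θ φ γ')) = doorFun θ φ γ' := funext (coeff_pexpo_doorElem θ φ γ')
  rw [e1, e2]

/-- Entry of a vertex column `{γ}`. -/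
theorem coeff_pexpo_prod_doorElem_singleton (θ : Fin h → Fin h → ℂ) (φ : Fin h → Fin h → Fin h → ℂ) (γ : Fin h) (U : Finset (Fin h)) :
    coeff (pexpo U ∅) (∏ y ∈ ({γ} : Finset (Fin h)), doorElem θ φ y) = doorFun θ φ γ U := by
  rw [Finset.prod_singleton, coeff_pexpo_doorElem]

/-- Entry of the empty column. -/
theorem coeff_pexpo_prod_doorElem_empty (θ : Fin h → Fin h → ℂ) (φ : Fin h → Fin h → Fin h → ℂ) (U : Finset (Fin h)) :
    coeff (pexpo U ∅) (∏ y ∈ (∅ : Finset (Fin h)), doorElem θ φ y) = if U = ∅ then 1 else 0 := by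
  rw [Finset.prod_empty, coeff_pexpo_one']

end Bridge

end SplitGeneral

end Summit.ValiantsHypothesis.ValiantsHypothesis.Theorems.BarrierLever.AnchoredPeeling
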